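import Mathlib
import Literature.Geometry.DiscreteGeometry.KissingPatterns
import Summits.AtomisticToContinuum.Crystallization.Theorems.DisclinationRationFiveFoldRationStubShellMutualAux
import Summits.AtomisticToContinuum.Crystallization.Theorems.DisclinationRationFiveFoldRationStubCappingAux
import Summits.AtomisticToContinuum.Crystallization.Theorems.DisclinationRationFiveFoldRationStubCappingCore

/-!
# Crux `DisclinationRation.FiveFoldRation` (stmt-AtomisticToContinuum-15799), line `Sketch` —
# stub `stub_dr5_capping`: Octahedron completion (front end 4)

Assuming shell symmetry, the link lemma and the dichotomy (as hypotheses BY STATEMENT): every square face `t₁ t₂ t₃ t₄` of the link of a site `y` of an everywhere-alphabet-good Delone set (consecutively shell-adjacent shell points of `y`, diagonals not shell-adjacent, `t₁ ≠ t₃`, `t₂ ≠ t₄`) is capped by a site `x ∈ S`, `x ≠ y`, outside the shell of `y`, in the shells of all four `tᵢ`.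

Registered signature: `Cruxes/FiveFoldRation/Lines/Sketch.lean` (v4), `let`-abbreviated style where applicable.

Proof: the stub is the specialisation of `dr5ca_core` (`…StubCappingCore`: parallelogram at `y`,
square corner `(y; t₂, t₄)` read in the shell of `t₁` giving the cap `x ≈ t₂ + t₄ - y`, square
corner `(y; t₁, t₃)` read in the shell of `t₂` giving the same site by separation of shell points)
to `nd S`, `Sh S`, the three hypotheses BY STATEMENT, and the pattern data of the three alphabet
patterns: unit norms and pairwise `≥ 1` (library / `…StubShellMutualAux`), spectrum gap
`(26/25, 7/5)` (`…StubCappingAux`), and the two dichotomy clauses (hypothesis).  Helper prefix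
`dr5ca_`.
-/

noncomputable section

namespace Summit.AtomisticToContinuum.Crystallization.Theorems

open Literature.Geometry.DiscreteGeometry

/-- Assuming shell symmetry, the link lemma and the dichotomy (as hypotheses BY STATEMENT): every square face `t₁ t₂ t₃ t₄` of the link of a site `y` of an everywhere-alphabet-good Delone set (consecutively shell-adjacent shell points of `y`, diagonals not shell-adjacent, `t₁ ≠ t₃`, `t₂ ≠ t₄`) is capped by a site `x ∈ S`, `x ≠ y`, outside the shell of `y`, in the shells of all four `tᵢ`. -/
theorem stub_dr5_capping : (let Dc := {p : EuclideanSpace ℝ (Fin 3) | p = !₂[(0 : ℝ), 0, 1] ∨ p = !₂[(0 : ℝ), 0, -1] ∨ ∃ k : Fin 5, ∃ σ : ℝ, (σ = 1 / 2 ∨ σ = -(1 / 2)) ∧ p = !₂[Real.sqrt 3 / 2 * Real.cos (2 * Real.pi * (k : ℝ) / 5), Real.sqrt 3 / 2 * Real.sin (2 * Real.pi * (k : ℝ) / 5), σ]}; let nd := fun (S : Set (EuclideanSpace ℝ (Fin 3))) (y : EuclideanSpace ℝ (Fin 3)) => sInf ((fun z => dist z y) '' (S \ {y})); let Sh := fun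 (S : Set (EuclideanSpace ℝ (Fin 3))) (y : EuclideanSpace ℝ (Fin 3)) => {z : EuclideanSpace ℝ (Fin 3) | z ∈ S ∧ z ≠ y ∧ dist z y < 13 / 10 * nd S y}; let F := fun (S : Set (EuclideanSpace ℝ (Fin 3))) (y : EuclideanSpace ℝ (Fin 3)) (A : EuclideanSpace ℝ (Fin 3) →ₗᵢ[ℝ] EuclideanSpace ℝ (Fin 3)) => ∃ e : ↥(Sh S y) ≃ ↥Literature.Geometry.DiscreteGeometry.fccKissingPattern, ∀ t : ↥(Sh S y), dist ((nd S y)⁻¹ • (t.1 - y)) (A (e t).1) ≤ 1 / 20; let H := fun (S : Set (EuclideanSpace ℝ (Fin 3))) (y : EuclideanSpace ℝ (Fin 3)) (A : EuclideanSpace ℝ (Fin 3) →ₗᵢ[ℝ] EuclideanSpace ℝ (Fin 3)) => ∃ e : ↥(Sh S y) ≃ ↥Literature.Geometry.DiscreteGeometry.hcpKissingPattern, ∀ t : ↥(Sh S y), dist ((nd S y)⁻¹ • (t.1 - y)) (A (e t).1) ≤ 1 / 20; let Tol := fun (S : Set (EuclideanSpace ℝ (Fin 3))) (y : EuclideanSpace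 ℝ (Fin 3)) (A : EuclideanSpace ℝ (Fin 3) →ₗᵢ[ℝ] EuclideanSpace ℝ (Fin 3)) (e : ↥(Sh S y) ≃ ↥Dc) => ∀ t : ↥(Sh S y), dist ((nd S y)⁻¹ • (t.1 - y)) (A (e t).1) ≤ 1 / 20; (∀ δ : ℝ, 0 < δ → ∀ S : Set (EuclideanSpace ℝ (Fin 3)), (∀ y ∈ S, ∀ z ∈ S, y ≠ z → δ ≤ dist y z) → (∃ R₁ : ℝ, ∀ p : EuclideanSpace ℝ (Fin 3), ∃ y ∈ S, dist y p ≤ R₁) → (∀ y ∈ S, ∃ A : EuclideanSpace ℝ (Fin 3) →ₗᵢ[ℝ] EuclideanSpace ℝ (Fin 3), F S y A ∨ H S y A ∨ ∃ e : ↥(Sh S y) ≃ ↥Dc, Tol S y A e) → ∀ y ∈ S, ∀ z ∈ S, z ≠ y → dist z y < 13 / 10 * nd S y → nd S y ≤ dist z y ∧ dist z y ≤ 21 / 20 * nd S y ∧ dist y z < 13 / 10 * nd S z ∧ dist y z ≤ 21 / 20 * nd S z) → (∀ δ : ℝ, 0 < δ → ∀ S : Set (EuclideanSpace ℝ (Fin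 3)), (∀ y ∈ S, ∀ z ∈ S, y ≠ z → δ ≤ dist y z) → (∃ R₁ : ℝ, ∀ p : EuclideanSpace ℝ (Fin 3), ∃ y ∈ S, dist y p ≤ R₁) → (∀ y ∈ S, ∃ A : EuclideanSpace ℝ (Fin 3) →ₗᵢ[ℝ] EuclideanSpace ℝ (Fin 3), F S y A ∨ H S y A ∨ ∃ e : ↥(Sh S y) ≃ ↥Dc, Tol S y A e) → ∀ P : Set (EuclideanSpace ℝ (Fin 3)), (∀ p ∈ P, ‖p‖ = 1) → (∀ p ∈ P, ∀ q ∈ P, p ≠ q → 1 ≤ dist p q) → (∀ p ∈ P, ∀ q ∈ P, dist p q ≤ 26 / 25 ∨ 7 / 5 ≤ dist p q) → ∀ y ∈ S, ∀ A : EuclideanSpace ℝ (Fin 3) →ₗᵢ[ℝ] EuclideanSpace ℝ (Fin 3), ∀ e : ↥(Sh S y) ≃ ↥P, (∀ t : ↥(Sh S y), dist ((nd S y)⁻¹ • (t.1 - y)) (A (e t).1) ≤ 1 / 20) → ∀ t t' : ↥(Sh S y), t ≠ t' → (t'.1 ∈ Sh S t.1 ↔ dist (e t).1 (e t').1 ≤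 26 / 25)) → (∀ P : Set (EuclideanSpace ℝ (Fin 3)), (P = (↑Literature.Geometry.DiscreteGeometry.fccKissingPattern : Set (EuclideanSpace ℝ (Fin 3))) ∨ P = (↑Literature.Geometry.DiscreteGeometry.hcpKissingPattern : Set (EuclideanSpace ℝ (Fin 3))) ∨ P = Dc) → (∀ Y ∈ P, ∀ T ∈ P, ∀ T' ∈ P, dist Y T ≤ 26 / 25 → dist Y T' ≤ 26 / 25 → T ≠ T' → 26 / 25 < dist T T' → ((T + T' - Y ∈ P ∧ dist T T' ≤ 3 / 2) ∨ ‖T + T' - Y‖ ≤ 61 / 100)) ∧ (∀ T₁ ∈ P, ∀ T₂ ∈ P, ∀ T₃ ∈ P, ∀ T₄ ∈ P, dist T₁ T₂ ≤ 26 / 25 → dist T₂ T₃ ≤ 26 / 25 → dist T₃ T₄ ≤ 26 / 25 → dist T₄ T₁ ≤ 26 / 25 → 26 / 25 < dist T₁ T₃ → 26 / 25 < dist T₂ T₄ → T₁ + T₃ = T₂ + T₄)) → (∀ δ : ℝ, 0 < δ → ∀ S : Set (EuclideanSpace ℝ (Fin 3)), (∀ y ∈ S, ∀ z ∈ S, y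 ≠ z → δ ≤ dist y z) → (∃ R₁ : ℝ, ∀ p : EuclideanSpace ℝ (Fin 3), ∃ y ∈ S, dist y p ≤ R₁) → (∀ y ∈ S, ∃ A : EuclideanSpace ℝ (Fin 3) →ₗᵢ[ℝ] EuclideanSpace ℝ (Fin 3), F S y A ∨ H S y A ∨ ∃ e : ↥(Sh S y) ≃ ↥Dc, Tol S y A e) → ∀ y ∈ S, ∀ t₁ ∈ Sh S y, ∀ t₂ ∈ Sh S y, ∀ t₃ ∈ Sh S y, ∀ t₄ ∈ Sh S y, t₂ ∈ Sh S t₁ → t₃ ∈ Sh S t₂ → t₄ ∈ Sh S t₃ → t₁ ∈ Sh S t₄ → t₃ ∉ Sh S t₁ → t₄ ∉ Sh S t₂ → t₁ ≠ t₃ → t₂ ≠ t₄ → ∃ x ∈ S, x ≠ y ∧ x ∉ Sh S y ∧ x ∈ Sh S t₁ ∧ x ∈ Sh S t₂ ∧ x ∈ Sh S t₃ ∧ x ∈ Sh S t₄)) := by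
  intro Dc nd Sh F H Tol hSM hLINKS hDICHO δ hδ S hsep hRD hgood y hy t₁ ht₁ t₂ ht₂ t₃ ht₃ t₄ ht₄ h12
    h23 h34 h41 h13 h24 hne13 hne24
  refine dr5ca_core (S := S) (nd := nd S) (Sh := Sh S) (fun _ _ => Iff.rfl)
    (hSM δ hδ S hsep hRD hgood) (hLINKS δ hδ S hsep hRD hgood) ?_ hy ht₁ ht₂ ht₃ ht₄ h12 h23 h34
    h41 h13 h24 hne13 hne24
  intro u hu
  obtain ⟨A, ⟨e, he⟩ | ⟨e, he⟩ | ⟨e, he⟩⟩ := hgood u hu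
  · exact ⟨_, fun p hp => norm_eq_one_of_mem_fccKissingPattern hp,
      fun p hp q hq hne => one_le_dist_of_mem_fccKissingPattern hp hq hne, dr5ca_fcc_gap,
      (hDICHO _ (Or.inl rfl)).1, (hDICHO _ (Or.inl rfl)).2, A, e, he⟩
  · exact ⟨_, fun p hp => norm_eq_one_of_mem_hcpKissingPattern hp,
      fun p hp q hq hne => one_le_dist_of_mem_hcpKissingPattern hp hq hne, dr5ca_hcp_gap,
      (hDICHO _ (Or.inr (Or.inl rfl))).1, (hDICHO _ (Or.inr (Or.inl rfl))).2, A, e, he⟩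
  · exact ⟨Dc, dr5sm_deca_norm, fun p hp q hq hne => dr5sm_deca_sep p q hp hq hne,
      dr5ca_deca_gap, (hDICHO Dc (Or.inr (Or.inr rfl))).1, (hDICHO Dc (Or.inr (Or.inr rfl))).2,
      A, e, he⟩

end Summit.AtomisticToContinuum.Crystallization.Theorems

end
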